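import Summits.SmoothPoincare4.SmoothPoincare4.Theorems.EntropyRungChangGurskyYangStubPathMapStrictFDeriv
import Literature.Geometry.Riemannian.GurskyViaclovskyClosednessBootstrapAux
import Literature.Geometry.Riemannian.GurskyViaclovskyEllipticityC2
import Literature.Analysis.Calculus.EllipticityNearGraph
import Literature.Analysis.FunctionSpaces.HolderBallDataSmooth
import Mathlib.Analysis.Calculus.BumpFunction.FiniteDimension
import HarnessLib

/-!
# Stub O3b `stub_regularity_of_induction`: `C^{2,α}_𝔄` solutions of the weighted `σ₂` path
# equation are `C^∞`, from the chart-level regularity induction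
# (line `margerin-cone-hamilton-rails`, crux `EntropyRung.ChangGurskyYang`, stmt-SmoothPoincare4-10834)

The registered stub `stub_regularity_of_induction` of the crux skeleton
`Cruxes/ChangGurskyYang/Lines/margerin_cone_hamilton_rails.lean`: the manifold-level assembly of
the regularity half of Gilbarg–Trudinger's Lemma 17.16 as used by Gursky–Viaclovsky (2003), §5
("since `f ∈ C^∞(M)`, it follows from classical elliptic regularity theory that `u_t ∈ C^∞(M)`").
Its hypothesis is the chart-level induction `helper_regularityInduction` (difference quotients +
interior Schauder + differentiation of the equation), a separate registered stub; this file reduces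
the manifold statement (stub O3 `stub_regularity` of the openness step) to it:

* around `x₀ ∈ M` pick a chart of the Hölder data `𝔄` whose cut-off is positive at `x₀`, cut
  `w ∘ chart⁻¹` off by a bump to a `C^{2,α}_b(ℝ⁴)` function `v`
  (`memContDiffHolder_smul_comp_symm`);
* write the equation near `chart x₀` as `H(c(y), J²v(y)) = 0` with
  `H(p, J) = −𝒩(t, p, (J₀, pOf J, rOf J))`, `𝒩` the globally smooth chart structure function
  (`exists_contDiff_chartStructure`) and `c = (|W_g|² ∘ chart⁻¹, q ∘ chart⁻¹, G, ♯, Γ, Ric)` the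
  smooth coefficient field of the pulled-back metric
  (`backgroundPathOperator_chart_eq_chartOperator_of_contMDiff_two`);
* strict ellipticity along the graph from admissibility and `t ≤ 1`
  (`fderiv_jetOperator_single_pos_of_contDiffAt_two` = Gursky–Viaclovsky Prop. 1 (ii) along a `C²`
  solution, transported to the pulled-back metric by `backgroundPathOperator_comap_of_contMDiffAt_two`
  / `backgroundScalar_comap_of_contMDiffAt_two`), made uniform near the graph by compactness
  (`exists_ellipticity_nhds_graph_of_pos`);
* the induction for every order `m`, `contDiffOn_infty`, and back to the manifold through the chart.

## References

* M. J. Gursky, J. A. Viaclovsky, *A fully nonlinear equation on four-manifolds with positive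
  scalar curvature*, J. Differential Geom. 63 (2003) 131–154, §5. [GurskyViaclovsky2003]
* D. Gilbarg, N. S. Trudinger, *Elliptic Partial Differential Equations of Second Order* (2001),
  Lemma 17.16, §4.1. [GilbargTrudinger2001]
-/

noncomputable section

set_option linter.dupNamespace false
set_option maxSynthPendingDepth 3

open Set Function Filter Metric
open scoped Manifold ContDiff Topology NNReal



/-! ### The stub -/

namespace Summit.SmoothPoincare4.SmoothPoincare4.Theorems.MargerinRails

open Literature.Analysis.FunctionSpaces Literature.Analysis.Calculus Literature.Geometry.Riemannian
open Literature.Geometry.Riemannian.GurskyViaclovskyPath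
open Literature.Geometry.Lorentzian Literature.Geometry.Lorentzian.PseudoRiemannianMetric
open Literature.Geometry.Lorentzian.MetricCoord


set_option maxHeartbeats 1600000 in
/-- **STUB O3b — `stub_regularity` FROM THE REGULARITY INDUCTION** (Gilbarg–Trudinger Lemma 17.16,
regularity half, assembled on the manifold; see the module docstring for the construction): given
the chart-level induction `helper_regularityInduction`, every admissible `C^{2,α}_𝔄` solution `w` of
the weighted `σ₂` path equation with `t ≤ 1` and smooth positive right side is `C^∞`.
[cite: GurskyViaclovsky2003, §5] [cite: GilbargTrudinger2001, Lemma 17.16] -/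
theorem stub_regularity_of_induction :
    (∀ {ι : Type} [Fintype ι] [DecidableEq ι] {E : Type} [NormedAddCommGroup E] [InnerProductSpace ℝ E]
      [FiniteDimensional ℝ E] [MeasurableSpace E] [BorelSpace E] [Nontrivial E]
      (bE : OrthonormalBasis ι ℝ E) {α : NNReal}, 0 < α → α < 1 → ∀ (m : ℕ)
      {P : Type} [NormedAddCommGroup P] [NormedSpace ℝ P] [FiniteDimensional ℝ P]
      (H : P × Literature.Analysis.Calculus.CJet ι 2 → ℝ),
      ContDiff ℝ ((⊤ : ℕ∞) : WithTop ℕ∞) H →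
      ∀ (c : E → P) (v : E → ℝ) (x₀ : E) (R : ℝ), 0 < R →
      ContDiffOn ℝ (m + 1) c (Metric.ball x₀ R) →
      (∃ Bc : NNReal, (∀ y ∈ Metric.ball x₀ R, ∀ j ≤ m + 1, ‖iteratedFDeriv ℝ j c y‖ ≤ Bc) ∧
        HolderOnWith Bc α (iteratedFDeriv ℝ (m + 1) c) (Metric.ball x₀ R)) →
      ContDiffOn ℝ 2 v (Metric.ball x₀ R) →
      (∃ Bv : NNReal, (∀ y ∈ Metric.ball x₀ R, ∀ j ≤ 2, ‖iteratedFDeriv ℝ j v y‖ ≤ Bv) ∧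
        HolderOnWith Bv α (iteratedFDeriv ℝ 2 v) (Metric.ball x₀ R)) →
      (∀ y ∈ Metric.ball x₀ R, H (c y, Literature.Analysis.Calculus.cjetOf bE 2 v y) = 0) →
      (∃ l δ : ℝ, 0 < l ∧ 0 < δ ∧ ∀ y ∈ Metric.ball x₀ R,
        ∀ (p' : P) (J' : Literature.Analysis.Calculus.CJet ι 2),
          ‖p' - c y‖ < δ → ‖J' - Literature.Analysis.Calculus.cjetOf bE 2 v y‖ < δ →
          ∀ η : E →L[ℝ] ℝ, l * ‖η‖ ^ 2 ≤
            fderiv ℝ H (p', J') ((0 : P), Pi.single (Fin.last 2)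
              (fun I : Fin 2 → ι => η (bE (I 0)) * η (bE (I 1))))) →
      ∀ ρ : ℝ, 0 < ρ → ρ < R →
        ContDiffOn ℝ (m + 3) v (Metric.ball x₀ ρ) ∧
        ∃ B' : NNReal, (∀ y ∈ Metric.ball x₀ ρ, ∀ j ≤ m + 3, ‖iteratedFDeriv ℝ j v y‖ ≤ B') ∧
          HolderOnWith B' α (iteratedFDeriv ℝ (m + 3) v) (Metric.ball x₀ ρ)) →
    ∀ (M : Type) [TopologicalSpace M] [T2Space M] [ChartedSpace (EuclideanSpace ℝ (Fin 4)) M]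
      [IsManifold (modelWithCornersSelf ℝ (EuclideanSpace ℝ (Fin 4))) ((⊤ : ℕ∞) : WithTop ℕ∞) M]
      [CompactSpace M] {ι : Type} [Fintype ι]
      (𝔄 : Literature.Analysis.FunctionSpaces.HolderChartData ι (EuclideanSpace ℝ (Fin 4)) M)
      (g : Literature.Geometry.Lorentzian.PseudoRiemannianMetric
        (modelWithCornersSelf ℝ (EuclideanSpace ℝ (Fin 4))) ((⊤ : ℕ∞) : WithTop ℕ∞)
        (EuclideanSpace ℝ (Fin 4))
        (TangentSpace (modelWithCornersSelf ℝ (EuclideanSpace ℝ (Fin 4))) : M → Type _))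
      [g.HasLeviCivita], g.IsRiemannian →
      ∀ (q : M → ℝ), ContMDiff (modelWithCornersSelf ℝ (EuclideanSpace ℝ (Fin 4)))
        (modelWithCornersSelf ℝ ℝ) ((⊤ : ℕ∞) : WithTop ℕ∞) q → (∀ x, 0 < q x) →
      ∀ {α : NNReal}, 0 < α → α < 1 →
      ∀ (t : ℝ), t ≤ 1 → ∀ (w : Literature.Analysis.FunctionSpaces.HolderManifoldFunction 𝔄 ℝ 2 α),
      (∀ x, 0 < Literature.Geometry.Riemannian.GurskyViaclovskyPath.backgroundScalar g w x) →
      (∀ x, Literature.Geometry.Riemannian.GurskyViaclovskyPath.backgroundPathOperator g t w x =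
        q x * Real.exp (-4 * w x)) →
      ContMDiff (modelWithCornersSelf ℝ (EuclideanSpace ℝ (Fin 4))) (modelWithCornersSelf ℝ ℝ)
        ((⊤ : ℕ∞) : WithTop ℕ∞) (w : M → ℝ) := by
  intro hind M _ _ _ _ _ ι _ 𝔄 g _ hg q hq hq0 α hα0 hα1 t ht w hadm heq x₀
  classical
  have hw2 : ContMDiff (𝓡 4) 𝓘(ℝ) 2 (w : M → ℝ) := w.contMDiff
  /- (1) a chart of the data whose source contains `x₀` -/
  obtain ⟨j, hj⟩ : ∃ j, 𝔄.ρ j x₀ ≠ 0 := by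
    by_contra! h
    have h1 := 𝔄.sum_smul_eq x₀ (1 : ℝ)
    simp only [h, zero_smul, Finset.sum_const_zero] at h1
    exact zero_ne_one h1
  set c₀ : M := 𝔄.center j with hc₀
  have hx₀ : x₀ ∈ (chartAt (EuclideanSpace ℝ (Fin 4)) c₀).source := by
    by_contra h
    exact hj (𝔄.ρ_eq_zero h)
  set y₀ : (EuclideanSpace ℝ (Fin 4)) := chartAt (EuclideanSpace ℝ (Fin 4)) c₀ x₀ with hy₀def
  have hy₀ : y₀ ∈ (chartAt (EuclideanSpace ℝ (Fin 4)) c₀).target := (chartAt (EuclideanSpace ℝ (Fin 4)) c₀).map_source hx₀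
  obtain ⟨ε, hε, hεt⟩ := Metric.isOpen_iff.1 (chartAt (EuclideanSpace ℝ (Fin 4)) c₀).open_target y₀ hy₀
  /- (2) the pulled-back metric on the chart target and its components -/
  set U : TopologicalSpace.Opens (EuclideanSpace ℝ (Fin 4)) :=
    ⟨(chartAt (EuclideanSpace ℝ (Fin 4)) c₀).target, (chartAt (EuclideanSpace ℝ (Fin 4)) c₀).open_target⟩ with hUdef
  have hUt : (U : Set (EuclideanSpace ℝ (Fin 4))) = (chartAt (EuclideanSpace ℝ (Fin 4)) c₀).target := rfl
  set Φ : U → M := fun u ↦ (chartAt (EuclideanSpace ℝ (Fin 4)) c₀).symm u with hΦdef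
  have hΦ : ContMDiff 𝓘(ℝ, (EuclideanSpace ℝ (Fin 4))) 𝓘(ℝ, (EuclideanSpace ℝ (Fin 4))) (∞ + 1) Φ := ChartInverseSelf.contMDiff_symm c₀
  have hΦ' : ∀ u, Function.Injective (mfderiv 𝓘(ℝ, (EuclideanSpace ℝ (Fin 4))) 𝓘(ℝ, (EuclideanSpace ℝ (Fin 4))) Φ u) :=
    ChartInverseSelf.injective_mfderiv_symm c₀
  have hdim : Module.finrank ℝ (EuclideanSpace ℝ (Fin 4)) = Module.finrank ℝ (EuclideanSpace ℝ (Fin 4)) := rfl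
  have hpb : contMDiff_pullbackBilin 𝓘(ℝ, (EuclideanSpace ℝ (Fin 4))) M 𝓘(ℝ, (EuclideanSpace ℝ (Fin 4))) U ∞ := contMDiff_pullbackBilin_holds
  set gU := g.comap hpb Φ hΦ hΦ' hdim with hgUdef
  haveI : gU.HasLeviCivita := gU.hasLeviCivita
  set G : (EuclideanSpace ℝ (Fin 4)) → (EuclideanSpace ℝ (Fin 4)) →L[ℝ] (EuclideanSpace ℝ (Fin 4)) →L[ℝ] ℝ :=
    Function.extend (Subtype.val : U → (EuclideanSpace ℝ (Fin 4)))
      (fun y : U ↦ (gU.val y : (EuclideanSpace ℝ (Fin 4)) →L[ℝ] (EuclideanSpace ℝ (Fin 4)) →L[ℝ] ℝ)) (fun _ ↦ 0) with hGdef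
  have hG : ∀ y : U, gU.val y = G y := fun y ↦ by
    rw [hGdef, Subtype.val_injective.extend_apply]
  have hmet : IsMetricOn G (U : Set (EuclideanSpace ℝ (Fin 4))) := OpensChart.isMetricOn_repr hG
  have hgUR : gU.IsRiemannian := fun z v hv ↦ by
    have h1 : gU.val z v v = g.val (Φ z) (mfderiv 𝓘(ℝ, (EuclideanSpace ℝ (Fin 4))) 𝓘(ℝ, (EuclideanSpace ℝ (Fin 4))) Φ z v)
        (mfderiv 𝓘(ℝ, (EuclideanSpace ℝ (Fin 4))) 𝓘(ℝ, (EuclideanSpace ℝ (Fin 4))) Φ z v) := rfl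
    rw [h1]
    exact hg _ _ fun h0 ↦ hv ((hΦ' z) (by
      rw [h0]
      exact ((mfderiv 𝓘(ℝ, (EuclideanSpace ℝ (Fin 4))) 𝓘(ℝ, (EuclideanSpace ℝ (Fin 4))) Φ z).map_zero).symm))
  set W : (EuclideanSpace ℝ (Fin 4)) → ℝ := fun z ↦ g.weylNormSq ((chartAt (EuclideanSpace ℝ (Fin 4)) c₀).symm z) with hWdef
  have hWy : ∀ y : U, W y = gU.weylNormSq y := fun y ↦
    (g.weylNormSq_comap hpb hΦ hΦ' hdim hg y).symm
  have hW : ContDiffOn ℝ ∞ W (U : Set (EuclideanSpace ℝ (Fin 4))) := contDiffOn_of_eq_weylNormSq gU hG hgUR hWy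
  set Q : (EuclideanSpace ℝ (Fin 4)) → ℝ := fun z ↦ q ((chartAt (EuclideanSpace ℝ (Fin 4)) c₀).symm z) with hQdef
  have hQ : ContDiffOn ℝ ∞ Q (U : Set (EuclideanSpace ℝ (Fin 4))) := contDiffOn_comp_chart_symm hq c₀ Subset.rfl
  /- (3) the structure function `𝒩`, the equation function `H`, the coefficient field `cf` -/
  obtain ⟨𝒩, h𝒩, h𝒩_eq⟩ := exists_contDiff_chartStructure (E := (EuclideanSpace ℝ (Fin 4)))
  set bE : OrthonormalBasis (Fin 4) ℝ (EuclideanSpace ℝ (Fin 4)) := EuclideanSpace.basisFun (Fin 4) ℝ with hbE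
  obtain ⟨H, hH_eq⟩ : ∃ H : (ℝ × (ℝ × ((EuclideanSpace ℝ (Fin 4) →L[ℝ] EuclideanSpace ℝ (Fin 4) →L[ℝ] ℝ) × (((EuclideanSpace ℝ (Fin 4) →L[ℝ] ℝ) →L[ℝ] EuclideanSpace ℝ (Fin 4)) × ((EuclideanSpace ℝ (Fin 4) →L[ℝ] EuclideanSpace ℝ (Fin 4) →L[ℝ] EuclideanSpace ℝ (Fin 4)) × (EuclideanSpace ℝ (Fin 4) →L[ℝ] EuclideanSpace ℝ (Fin 4) →L[ℝ] ℝ)))))) × CJet (Fin 4) 2 → ℝ, ∀ (p : (ℝ × (ℝ × ((EuclideanSpace ℝ (Fin 4) →L[ℝ] EuclideanSpace ℝ (Fin 4) →L[ℝ] ℝ) × (((EuclideanSpace ℝ (Fin 4) →L[ℝ] ℝ) →L[ℝ] EuclideanSpace ℝ (Fin 4)) × ((EuclideanSpace ℝ (Fin 4) →L[ℝ] EuclideanSpace ℝ (Fin 4) →L[ℝ] EuclideanSpace ℝ (Fin 4)) × (EuclideanSpace ℝ (Fin 4) →L[ℝ] EuclideanSpace ℝ (Fin 4) →L[ℝ]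 ℝ))))))) (J : CJet (Fin 4) 2),
      H (p, J) = -𝒩 (t, p, (J 0 Fin.elim0, pOf bE J, rOf bE J)) :=
    ⟨fun z => -𝒩 (t, z.1, (z.2 0 Fin.elim0, pOf bE z.2, rOf bE z.2)), fun _ _ => rfl⟩
  have hHfun : H = fun z => -𝒩 (t, z.1, (z.2 0 Fin.elim0, pOf bE z.2, rOf bE z.2)) :=
    funext fun z => hH_eq z.1 z.2
  have hH : ContDiff ℝ ∞ H := by
    have h0 : ContDiff ℝ ∞ (fun J : CJet (Fin 4) 2 ↦ J 0 Fin.elim0) :=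
      contDiff_pi.1 (contDiff_pi.1 contDiff_id 0) _
    have hin : ContDiff ℝ ∞ fun z : (ℝ × (ℝ × ((EuclideanSpace ℝ (Fin 4) →L[ℝ] EuclideanSpace ℝ (Fin 4) →L[ℝ] ℝ) × (((EuclideanSpace ℝ (Fin 4) →L[ℝ] ℝ) →L[ℝ] EuclideanSpace ℝ (Fin 4)) × ((EuclideanSpace ℝ (Fin 4) →L[ℝ] EuclideanSpace ℝ (Fin 4) →L[ℝ] EuclideanSpace ℝ (Fin 4)) × (EuclideanSpace ℝ (Fin 4) →L[ℝ] EuclideanSpace ℝ (Fin 4) →L[ℝ] ℝ)))))) × CJet (Fin 4) 2 =>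
        ((t, z.1, (z.2 0 Fin.elim0, pOf bE z.2, rOf bE z.2)) :
          ℝ × (ℝ × (ℝ × ((EuclideanSpace ℝ (Fin 4) →L[ℝ] EuclideanSpace ℝ (Fin 4) →L[ℝ] ℝ) × (((EuclideanSpace ℝ (Fin 4) →L[ℝ] ℝ) →L[ℝ] EuclideanSpace ℝ (Fin 4)) × ((EuclideanSpace ℝ (Fin 4) →L[ℝ] EuclideanSpace ℝ (Fin 4) →L[ℝ] EuclideanSpace ℝ (Fin 4)) × (EuclideanSpace ℝ (Fin 4) →L[ℝ] EuclideanSpace ℝ (Fin 4) →L[ℝ] ℝ)))))) × (ℝ × ((EuclideanSpace ℝ (Fin 4)) →L[ℝ] ℝ) × ((EuclideanSpace ℝ (Fin 4)) →L[ℝ] (EuclideanSpace ℝ (Fin 4)) →L[ℝ] ℝ))) :=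
      contDiff_const.prodMk (contDiff_fst.prodMk ((h0.comp contDiff_snd).prodMk
        (((isBoundedLinearMap_pOf bE).contDiff.comp contDiff_snd).prodMk
          ((isBoundedLinearMap_rOf bE).contDiff.comp contDiff_snd))))
    rw [hHfun]
    exact (h𝒩.comp hin).neg
  obtain ⟨cf, hcf_eq⟩ : ∃ cf : (EuclideanSpace ℝ (Fin 4)) → (ℝ × (ℝ × ((EuclideanSpace ℝ (Fin 4) →L[ℝ] EuclideanSpace ℝ (Fin 4) →L[ℝ] ℝ) × (((EuclideanSpace ℝ (Fin 4) →L[ℝ] ℝ) →L[ℝ] EuclideanSpace ℝ (Fin 4)) × ((EuclideanSpace ℝ (Fin 4) →L[ℝ] EuclideanSpace ℝ (Fin 4) →L[ℝ] EuclideanSpace ℝ (Fin 4)) × (EuclideanSpace ℝ (Fin 4) →L[ℝ] EuclideanSpace ℝ (Fin 4) →L[ℝ] ℝ)))))), ∀ y, cf y =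
      (W y, Q y, G y, sharpAt G y, chrAt G y, ricAt G y) := ⟨_, fun _ => rfl⟩
  have hcU : ContDiffOn ℝ ∞ cf (U : Set (EuclideanSpace ℝ (Fin 4))) := by
    rw [show cf = fun y => (W y, Q y, G y, sharpAt G y, chrAt G y, ricAt G y) from funext hcf_eq]
    exact hW.prodMk (hQ.prodMk (hmet.contDiffOn.prodMk (hmet.contDiffOn_sharpAt.prodMk
      (hmet.contDiffOn_chrAt.prodMk hmet.contDiffOn_ricAt))))
  -- the slice of `H` at a coefficient value `cf y`
  have hslice : ∀ (y : (EuclideanSpace ℝ (Fin 4))) (J : CJet (Fin 4) 2), H (cf y, J) =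
      -(chartOperator G t (W y) y (-pOf bE J) (-rOf bE J) - Q y * Real.exp (-4 * J 0 Fin.elim0)) := by
    intro y J
    rw [hH_eq, hcf_eq, h𝒩_eq]
  /- (4) the chart representative of `w` and its cut-off -/
  set wh : (EuclideanSpace ℝ (Fin 4)) → ℝ := fun z => w ((chartAt (EuclideanSpace ℝ (Fin 4)) c₀).symm z) with hwhdef
  have hwh2 : ∀ y ∈ (chartAt (EuclideanSpace ℝ (Fin 4)) c₀).target, ContDiffAt ℝ 2 wh y := fun y hy =>
    contDiffAt_comp_chart_symm_of_contMDiffAt c₀ hy (hw2 _)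
  have h4 : (0 : ℝ) < ε / 4 := by positivity
  let β : ContDiffBump y₀ := ⟨ε / 4, ε / 2, h4, by linarith⟩
  have hβs : tsupport β ⊆ (chartAt (EuclideanSpace ℝ (Fin 4)) c₀).target := by
    rw [β.tsupport_eq]
    exact (closedBall_subset_ball (by show ε / 2 < ε; linarith)).trans hεt
  obtain ⟨v, hv_eq⟩ : ∃ v : (EuclideanSpace ℝ (Fin 4)) → ℝ, ∀ y, v y = β y * wh y := ⟨_, fun _ => rfl⟩
  have hv : MemContDiffHolder 2 α v := by
    rw [show v = fun y => β y • w ((𝔄.chart j).symm y) from funext fun y => by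
      rw [hv_eq, smul_eq_mul]]
    exact memContDiffHolder_smul_comp_symm 𝔄 hα1.le w j β.contDiff β.hasCompactSupport hβs
  have hvwh : ∀ y ∈ ball y₀ (ε / 4), v =ᶠ[𝓝 y] wh := fun y hy => by
    filter_upwards [β.eventuallyEq_one_of_mem_ball hy] with z hz
    rw [hv_eq, hz, Pi.one_apply, one_mul]
  set R : ℝ := ε / 8 with hRdef
  have hR : 0 < R := by positivity
  have hRball : closedBall y₀ R ⊆ ball y₀ (ε / 4) :=
    closedBall_subset_ball (by show ε / 8 < ε / 4; linarith)
  have hballU : ball y₀ (ε / 4) ⊆ (chartAt (EuclideanSpace ℝ (Fin 4)) c₀).target :=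
    (ball_subset_ball (by linarith)).trans hεt
  have hbRU : ball y₀ R ⊆ (chartAt (EuclideanSpace ℝ (Fin 4)) c₀).target :=
    (ball_subset_closedBall.trans hRball).trans hballU
  /- (6) `C^{2,α}` data of `v` on the ball -/
  have hvC2 : ContDiff ℝ 2 v := hv.contDiff
  have hv_diff : ContDiffOn ℝ 2 v (Metric.ball y₀ R) := hvC2.contDiffOn
  have hv_data : ∃ Bv : ℝ≥0, (∀ y ∈ Metric.ball y₀ R, ∀ i ≤ 2, ‖iteratedFDeriv ℝ i v y‖ ≤ Bv) ∧
      HolderOnWith Bv α (iteratedFDeriv ℝ 2 v) (Metric.ball y₀ R) := by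
    obtain ⟨C0, hC0⟩ := eSupNorm_lt_top_iff.1 (hv.2.1 0 (by norm_num))
    obtain ⟨C1, hC1⟩ := eSupNorm_lt_top_iff.1 (hv.2.1 1 (by norm_num))
    obtain ⟨C2, hC2⟩ := eSupNorm_lt_top_iff.1 (hv.2.1 2 le_rfl)
    obtain ⟨Ch, hCh⟩ := hv.2.2
    refine ⟨(max C0 (max C1 C2)).toNNReal + Ch, fun y _ i hi => ?_, ?_⟩
    · have hle : ‖iteratedFDeriv ℝ i v y‖ ≤ max C0 (max C1 C2) := by
        interval_cases i
        · exact (hC0 y).trans (le_max_left _ _)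
        · exact (hC1 y).trans ((le_max_left _ _).trans (le_max_right _ _))
        · exact (hC2 y).trans ((le_max_right _ _).trans (le_max_right _ _))
      calc ‖iteratedFDeriv ℝ i v y‖ ≤ max C0 (max C1 C2) := hle
        _ ≤ ((max C0 (max C1 C2)).toNNReal : ℝ) := Real.le_coe_toNNReal _
        _ ≤ (((max C0 (max C1 C2)).toNNReal + Ch : ℝ≥0) : ℝ) := by
            exact_mod_cast le_self_add
    · exact (HolderOnWith.mono_const (fun x _ z _ => hCh x z) le_add_self)
  /- (7) `C^{m+1,α}` data of the coefficients on the ball, for every `m` -/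
  have hc_data : ∀ m : ℕ, ContDiffOn ℝ (m + 1) cf (Metric.ball y₀ R) ∧ ∃ Bc : ℝ≥0,
      (∀ y ∈ Metric.ball y₀ R, ∀ i ≤ m + 1, ‖iteratedFDeriv ℝ i cf y‖ ≤ Bc) ∧
      HolderOnWith Bc α (iteratedFDeriv ℝ (m + 1) cf) (Metric.ball y₀ R) := fun m =>
    holderData_succ_of_contDiffOn U.2 hcU (hRball.trans hballU) hα1.le m
  /- (8) the equation `H(cf y, J²v(y)) = 0` on the ball -/
  -- the chart equation for `w` at a point of the target
  have hce : ∀ y ∈ (chartAt (EuclideanSpace ℝ (Fin 4)) c₀).target, backgroundPathOperator g t w ((chartAt (EuclideanSpace ℝ (Fin 4)) c₀).symm y) =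
      chartOperator G t (W y) y (-fderiv ℝ wh y) (-fderiv ℝ (fderiv ℝ wh) y) := by
    intro y hyU
    have h := backgroundPathOperator_chart_eq_chartOperator_of_contMDiff_two g hg t
      (u := fun m => -w m) hw2.neg c₀ hyU
    simp only [neg_neg] at h
    have e1 : fderiv ℝ (fun z => -w ((chartAt (EuclideanSpace ℝ (Fin 4)) c₀).symm z)) y = -fderiv ℝ wh y := fderiv_neg
    have e2 : fderiv ℝ (fderiv ℝ fun z => -w ((chartAt (EuclideanSpace ℝ (Fin 4)) c₀).symm z)) y =
        -fderiv ℝ (fderiv ℝ wh) y := by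
      have e : fderiv ℝ (fun z => -w ((chartAt (EuclideanSpace ℝ (Fin 4)) c₀).symm z)) = fun z => -fderiv ℝ wh z := by
        funext z
        exact fderiv_neg
      rw [e]
      exact fderiv_neg
    rw [e1, e2] at h
    exact h
  -- jets of `v` are jets of `wh` on the small ball
  have hjet : ∀ y ∈ ball y₀ (ε / 4),
      cjetOf bE 2 v y 0 Fin.elim0 = wh y ∧ pOf bE (cjetOf bE 2 v y) = fderiv ℝ wh y ∧
        rOf bE (cjetOf bE 2 v y) = fderiv ℝ (fderiv ℝ wh) y := by
    intro y hy
    have hloc : v =ᶠ[𝓝 y] wh := hvwh y hy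
    have hvy : ContDiffAt ℝ 2 v y := (hwh2 y (hballU hy)).congr_of_eventuallyEq hloc
    refine ⟨?_, ?_, ?_⟩
    · rw [cjetOf_zero, hloc.eq_of_nhds]
    · rw [pOf_cjetOf, hloc.fderiv_eq]
    · rw [rOf_cjetOf bE hvy, hloc.fderiv.fderiv_eq]
  have hEq : ∀ y ∈ Metric.ball y₀ R, H (cf y, cjetOf bE 2 v y) = 0 := by
    intro y hy
    have hy4 : y ∈ ball y₀ (ε / 4) := hRball (ball_subset_closedBall hy)
    have hyU : y ∈ (chartAt (EuclideanSpace ℝ (Fin 4)) c₀).target := hballU hy4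
    obtain ⟨e0, e1, e2⟩ := hjet y hy4
    rw [hslice, e0, e1, e2, ← hce y hyU, heq]
    show -(q ((chartAt (EuclideanSpace ℝ (Fin 4)) c₀).symm y) * Real.exp (-4 * w ((chartAt (EuclideanSpace ℝ (Fin 4)) c₀).symm y)) -
      q ((chartAt (EuclideanSpace ℝ (Fin 4)) c₀).symm y) * Real.exp (-4 * w ((chartAt (EuclideanSpace ℝ (Fin 4)) c₀).symm y))) = 0
    rw [sub_self, neg_zero]
  /- (9) strict ellipticity along the graph over the closed ball -/
  have hopen : IsOpen {x : (EuclideanSpace ℝ (Fin 4)) × ℝ × CJet (Fin 4) 2 | x.1 ∈ (U : Set (EuclideanSpace ℝ (Fin 4)))} :=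
    U.2.preimage continuous_fst
  have hpos : ∀ y ∈ closedBall y₀ R, ∀ η : (EuclideanSpace ℝ (Fin 4)) →L[ℝ] ℝ, η ≠ 0 → 0 <
      fderiv ℝ H (cf y, cjetOf bE 2 v y) ((0 : (ℝ × (ℝ × ((EuclideanSpace ℝ (Fin 4) →L[ℝ] EuclideanSpace ℝ (Fin 4) →L[ℝ] ℝ) × (((EuclideanSpace ℝ (Fin 4) →L[ℝ] ℝ) →L[ℝ] EuclideanSpace ℝ (Fin 4)) × ((EuclideanSpace ℝ (Fin 4) →L[ℝ] EuclideanSpace ℝ (Fin 4) →L[ℝ] EuclideanSpace ℝ (Fin 4)) × (EuclideanSpace ℝ (Fin 4) →L[ℝ] EuclideanSpace ℝ (Fin 4) →L[ℝ] ℝ))))))), Pi.single (Fin.last 2)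
        (fun I : Fin 2 → Fin 4 => η (bE (I 0)) * η (bE (I 1)))) := by
    intro y hy η hη
    have hy4 : y ∈ ball y₀ (ε / 4) := hRball hy
    have hyU : y ∈ (chartAt (EuclideanSpace ℝ (Fin 4)) c₀).target := hballU hy4
    have hloc : v =ᶠ[𝓝 y] wh := hvwh y hy4
    have hwhy : ContDiffAt ℝ 2 wh y := hwh2 y hyU
    set J₁ : CJet (Fin 4) 2 := cjetOf bE 2 v y with hJ₁
    set D : CJet (Fin 4) 2 :=
      Pi.single (Fin.last 2) (fun I : Fin 2 → Fin 4 => η (bE (I 0)) * η (bE (I 1))) with hD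
    set Jf : (EuclideanSpace ℝ (Fin 4)) × ℝ × CJet (Fin 4) 2 → ℝ := fun x ↦
      chartOperator G x.2.1 (W x.1) x.1 (pOf bE x.2.2) (rOf bE x.2.2) -
        Q x.1 * Real.exp (4 * x.2.2 0 Fin.elim0) with hJf
    -- (a) the partial derivative of `H` along `(0, D)` as a derivative along a line
    have hHd : DifferentiableAt ℝ H (cf y, J₁) :=
      (hH.differentiable (by simp)).differentiableAt
    have hl1 : HasDerivAt (fun s : ℝ => ((cf y, J₁ + s • D) : (ℝ × (ℝ × ((EuclideanSpace ℝ (Fin 4) →L[ℝ] EuclideanSpace ℝ (Fin 4) →L[ℝ] ℝ) × (((EuclideanSpace ℝ (Fin 4) →L[ℝ] ℝ) →L[ℝ] EuclideanSpace ℝ (Fin 4)) × ((EuclideanSpace ℝ (Fin 4) →L[ℝ] EuclideanSpace ℝ (Fin 4) →L[ℝ] EuclideanSpace ℝ (Fin 4)) × (EuclideanSpace ℝ (Fin 4) →L[ℝ] EuclideanSpace ℝ (Fin 4) →L[ℝ] ℝ)))))) × CJet (Fin 4) 2))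
        (((0 : (ℝ × (ℝ × ((EuclideanSpace ℝ (Fin 4) →L[ℝ] EuclideanSpace ℝ (Fin 4) →L[ℝ] ℝ) × (((EuclideanSpace ℝ (Fin 4) →L[ℝ] ℝ) →L[ℝ] EuclideanSpace ℝ (Fin 4)) × ((EuclideanSpace ℝ (Fin 4) →L[ℝ] EuclideanSpace ℝ (Fin 4) →L[ℝ] EuclideanSpace ℝ (Fin 4)) × (EuclideanSpace ℝ (Fin 4) →L[ℝ] EuclideanSpace ℝ (Fin 4) →L[ℝ] ℝ))))))), D) : (ℝ × (ℝ × ((EuclideanSpace ℝ (Fin 4) →L[ℝ] EuclideanSpace ℝ (Fin 4) →L[ℝ] ℝ) × (((EuclideanSpace ℝ (Fin 4) →L[ℝ] ℝ) →L[ℝ] EuclideanSpace ℝ (Fin 4)) × ((EuclideanSpace ℝ (Fin 4) →L[ℝ] EuclideanSpace ℝ (Fin 4) →L[ℝ] EuclideanSpace ℝ (Fin 4)) × (EuclideanSpace ℝ (Fin 4) →L[ℝ] EuclideanSpace ℝ (Fin 4) →L[ℝ] ℝ)))))) × CJet (Fin 4) 2) 0 := by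
      have h1 : HasDerivAt (fun s : ℝ => J₁ + s • D) D 0 := by
        simpa using ((hasDerivAt_id (0 : ℝ)).smul_const D).const_add J₁
      exact (hasDerivAt_const (0 : ℝ) (cf y)).prodMk h1
    have hd1 : HasDerivAt (fun s : ℝ => H (cf y, J₁ + s • D))
        (fderiv ℝ H (cf y, J₁) ((0 : (ℝ × (ℝ × ((EuclideanSpace ℝ (Fin 4) →L[ℝ] EuclideanSpace ℝ (Fin 4) →L[ℝ] ℝ) × (((EuclideanSpace ℝ (Fin 4) →L[ℝ] ℝ) →L[ℝ] EuclideanSpace ℝ (Fin 4)) × ((EuclideanSpace ℝ (Fin 4) →L[ℝ] EuclideanSpace ℝ (Fin 4) →L[ℝ] EuclideanSpace ℝ (Fin 4)) × (EuclideanSpace ℝ (Fin 4) →L[ℝ] EuclideanSpace ℝ (Fin 4) →L[ℝ] ℝ))))))), D)) 0 :=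
      hHd.hasFDerivAt.comp_hasDerivAt_of_eq (0 : ℝ) hl1 (by simp)
    -- (b) the same function through the jet function `Jf`
    set x₁ : (EuclideanSpace ℝ (Fin 4)) × ℝ × CJet (Fin 4) 2 := (y, t, -J₁) with hx₁
    set v₁ : (EuclideanSpace ℝ (Fin 4)) × ℝ × CJet (Fin 4) 2 := ((0 : (EuclideanSpace ℝ (Fin 4))), (0 : ℝ), -D) with hv₁
    have hlp := (isBoundedLinearMap_pOf bE).toIsLinearMap
    have hlr := (isBoundedLinearMap_rOf bE).toIsLinearMap
    have hline : ∀ s : ℝ, H (cf y, J₁ + s • D) = -Jf (x₁ + s • v₁) := by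
      intro s
      have h1 : x₁ + s • v₁ = (y, t, -(J₁ + s • D)) := by
        simp only [hx₁, hv₁, Prod.smul_mk, smul_zero, Prod.mk_add_mk, add_zero, smul_neg, neg_add]
      rw [h1, hslice, hJf]
      simp only [hlp.map_neg, hlr.map_neg, Pi.neg_apply]
      congr 2
      ring_nf
    have hJd : DifferentiableAt ℝ Jf x₁ :=
      ((contDiffOn_jetOperator bE hmet hW hQ).differentiableOn (by simp)).differentiableAt
        (hopen.mem_nhds hyU)
    have hl2 : HasDerivAt (fun s : ℝ => x₁ + s • v₁) v₁ 0 := by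
      simpa using ((hasDerivAt_id (0 : ℝ)).smul_const v₁).const_add x₁
    have hd2 : HasDerivAt (fun s : ℝ => -Jf (x₁ + s • v₁)) (-(fderiv ℝ Jf x₁ v₁)) 0 :=
      (hJd.hasFDerivAt.comp_hasDerivAt_of_eq (0 : ℝ) hl2 (by simp)).neg
    rw [funext hline] at hd1
    have hident : fderiv ℝ H (cf y, J₁) ((0 : (ℝ × (ℝ × ((EuclideanSpace ℝ (Fin 4) →L[ℝ] EuclideanSpace ℝ (Fin 4) →L[ℝ] ℝ) × (((EuclideanSpace ℝ (Fin 4) →L[ℝ] ℝ) →L[ℝ] EuclideanSpace ℝ (Fin 4)) × ((EuclideanSpace ℝ (Fin 4) →L[ℝ] EuclideanSpace ℝ (Fin 4) →L[ℝ] EuclideanSpace ℝ (Fin 4)) × (EuclideanSpace ℝ (Fin 4) →L[ℝ] EuclideanSpace ℝ (Fin 4) →L[ℝ] ℝ))))))), D) =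
        fderiv ℝ Jf x₁ (((0 : (EuclideanSpace ℝ (Fin 4))), (0 : ℝ), D) : (EuclideanSpace ℝ (Fin 4)) × ℝ × CJet (Fin 4) 2) := by
      rw [hd1.unique hd2, hv₁,
        show ((((0 : (EuclideanSpace ℝ (Fin 4))), (0 : ℝ), -D)) : (EuclideanSpace ℝ (Fin 4)) × ℝ × CJet (Fin 4) 2) = -((0 : (EuclideanSpace ℝ (Fin 4))), (0 : ℝ), D) by
          simp, map_neg, neg_neg]
    -- (c) the jet of `-wh` at `y`
    have hJneg : -J₁ = cjetOf bE 2 (fun z => -wh z) y := by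
      rw [hJ₁]
      funext k I
      rw [Pi.neg_apply, Pi.neg_apply, cjetOf_apply, cjetOf_apply,
        (hloc.iteratedFDeriv ℝ (k : ℕ)).eq_of_nhds]
      rw [show (fun z => -wh z) = -wh from rfl, iteratedFDeriv_neg_apply]
      rfl
    -- (d) the equation and admissibility for the pulled-back metric at `⟨y, hyU⟩`
    have hyU' : y ∈ (U : Set (EuclideanSpace ℝ (Fin 4))) := hyU
    have hwΦ : ContMDiffAt (𝓡 4) 𝓘(ℝ) 2 (w : M → ℝ) (Φ ⟨y, hyU'⟩) := hw2 _
    have hfun : (fun z : U ↦ -(fun z : U => -wh (z : (EuclideanSpace ℝ (Fin 4)))) z) = ((w : M → ℝ) ∘ Φ) := by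
      funext z
      simp only [neg_neg, Function.comp_apply, hwhdef, hΦdef]
    have heqU : backgroundPathOperator gU t (fun z : U ↦ -(fun z : U => -wh (z : (EuclideanSpace ℝ (Fin 4)))) z) ⟨y, hyU'⟩ =
        Q y * Real.exp (-4 * (-(fun z : U => -wh (z : (EuclideanSpace ℝ (Fin 4)))) ⟨y, hyU'⟩)) := by
      rw [hfun]
      refine (backgroundPathOperator_comap_of_contMDiffAt_two g hpb hΦ hΦ' hdim hg t ⟨y, hyU'⟩
        hwΦ).trans ?_
      rw [heq]
      simp only [neg_neg, hΦdef, hQdef, hwhdef]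
    have hposU : 0 < backgroundScalar gU (fun z : U ↦ -(fun z : U => -wh (z : (EuclideanSpace ℝ (Fin 4)))) z) ⟨y, hyU'⟩ := by
      rw [hfun]
      exact lt_of_lt_of_eq (hadm _)
        (backgroundScalar_comap_of_contMDiffAt_two g hpb hΦ hΦ' hdim hg ⟨y, hyU'⟩ hwΦ).symm
    have key := fderiv_jetOperator_single_pos_of_contDiffAt_two gU hG hgUR bE hW hQ
      (f := fun z : U => -wh (z : (EuclideanSpace ℝ (Fin 4)))) (F := fun z => -wh z) (fun _ => rfl) ht ⟨y, hyU'⟩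
      hwhy.neg (hq0 _) heqU hposU hη
    rw [hident, hx₁, hJneg]
    exact key
  /- (10) uniform ellipticity near the graph -/
  have hc_cont : ContinuousOn cf (closedBall y₀ R) := hcU.continuousOn.mono (hRball.trans hballU)
  have hjv_cont : ContinuousOn (cjetOf bE 2 v) (closedBall y₀ R) := by
    refine Continuous.continuousOn (continuous_pi fun k => continuous_pi fun I => ?_)
    have hk : ((k : ℕ) : WithTop ℕ∞) ≤ 2 := by exact_mod_cast Fin.is_le k
    exact (ContinuousMultilinearMap.apply ℝ (fun _ : Fin (k : ℕ) => (EuclideanSpace ℝ (Fin 4))) ℝ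
      (fun l => bE (I l))).continuous.comp (hvC2.continuous_iteratedFDeriv hk)
  obtain ⟨l, δ, hl, hδ, hEll⟩ := exists_ellipticity_nhds_graph_of_pos bE
    (hH.of_le (by exact_mod_cast le_top)) hc_cont hjv_cont hpos
  /- (11) the induction, for every order -/
  have hreg : ∀ m : ℕ, ContDiffOn ℝ (m + 3) v (Metric.ball y₀ (R / 2)) := fun m =>
    (hind bE hα0 hα1 m H hH cf v y₀ R hR (hc_data m).1 (hc_data m).2 hv_diff hv_data hEq
      ⟨l, δ, hl, hδ, hEll⟩ (R / 2) (by positivity) (by linarith)).1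
  have hvinf : ContDiffOn ℝ ∞ v (ball y₀ (R / 2)) := by
    refine contDiffOn_infty.2 fun n => ?_
    exact (hreg n).of_le (by exact_mod_cast Nat.le_add_right n 3)
  have hvAt : ContDiffAt ℝ ∞ v y₀ := hvinf.contDiffAt (ball_mem_nhds y₀ (by positivity))
  have hwhAt : ContDiffAt ℝ ∞ wh y₀ :=
    hvAt.congr_of_eventuallyEq (hvwh y₀ (mem_ball_self h4)).symm
  -- (12) back to the manifold
  have h1 : ContMDiffAt 𝓘(ℝ, (EuclideanSpace ℝ (Fin 4))) 𝓘(ℝ) ∞ wh y₀ := contMDiffAt_iff_contDiffAt.2 hwhAt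
  have h2 : ContMDiffAt (𝓡 4) (𝓡 4) ∞ (chartAt (EuclideanSpace ℝ (Fin 4)) c₀) x₀ :=
    (contMDiffOn_chart (I := 𝓡 4) (x := c₀)).contMDiffAt ((chartAt (EuclideanSpace ℝ (Fin 4)) c₀).open_source.mem_nhds hx₀)
  have h3 : ContMDiffAt (𝓡 4) 𝓘(ℝ) ∞ (wh ∘ chartAt (EuclideanSpace ℝ (Fin 4)) c₀) x₀ := h1.comp x₀ h2
  refine h3.congr_of_eventuallyEq ?_
  filter_upwards [(chartAt (EuclideanSpace ℝ (Fin 4)) c₀).open_source.mem_nhds hx₀] with x hx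
  show w x = w ((chartAt (EuclideanSpace ℝ (Fin 4)) c₀).symm (chartAt (EuclideanSpace ℝ (Fin 4)) c₀ x))
  rw [(chartAt (EuclideanSpace ℝ (Fin 4)) c₀).left_inv hx]

end Summit.SmoothPoincare4.SmoothPoincare4.Theorems.MargerinRails

end
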